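import Summits.BirchSwinnertonDyer.BirchSwinnertonDyer.Theses.QuadraticBranchSignedControl
import Summits.BirchSwinnertonDyer.BirchSwinnertonDyer.Theorems.QuadraticBranchSignedControlPlusEtaNonsurjOfCMCongruentTransfer
import Summits.BirchSwinnertonDyer.BirchSwinnertonDyer.Theorems.QuadraticBranchSignedControlPlusEtaNonsurjMuBound
import Summits.BirchSwinnertonDyer.BirchSwinnertonDyer.Theorems.QuadraticBranchSignedControlPlusEtaNonsurjPrimeLFunction
import HarnessLib

/-!
**ADOPTED as skeleton v7 of item stmt-BirchSwinnertonDyer-19606 by planner bsd-potss-plan g24 (2026-08-27T19:20Z)** — seat k8eta-c2 g8's candidate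
(`pub/bsd-potss/k8eta-c2/g8/PlusEtaMainConjectureNonsurj_birth_v7_candidate.lean`, sha16 50a555f257237dc2) byte-identical below this note;
supersedes the registered v5 (file sha16 a093d8c31df3, archived `Lines/v5_conjAPartners_g23.lean`, ns `.BirthV5`; v6 = k8eta-c2 g7's candidate,
never registered, superseded by this cut). My own `lean check`: rc 0, FIVE `sorry`s = five stubs, `PlusEtaMainConjectureNonsurj_of` a REAL proof
concluding the K8 decl by name through p559644 `EtaCMCongruentTransfer.plusEtaMainConjectureNonsurj_of_cmConjA_of_transfer_of_uncongruent`
(ACCEPTED 19:06Z). STUB MAP v7: two cite/binder inputs (`stub_etaMC_publishedInputs` = Kobayashi Thm 2.2η ∧ Thm 6.2/6.3/7.3 i)/Cor 7.2η ∧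
Burungale–Tian Thm 2.6, never a prover target; `stub_etaMC_transferCL25` := `CorpuzLei2025_etaPlusMainConjecture_transfer_anMu_OPEN` — an
`@[conjecture]`-level PREPRINT binder (arXiv:2508.09733 Thms 1–3 at i = (p−1)/2), NOT a prover target and NOT a Literature fact: it closes only
when refereed AND typed by a dictionary reader (flag `CL25-eta-plus-dictionary`), or when re-proved here) + three content stubs
(`stub_conjA_partners_cm` = Coates–Sujatha (A) on the CM partners only; `stub_analyticEtaMu_cm` = analytic μ = 0 on the CM rows;
`stub_etaMC_nonCM_uncongruent` = (C1⁺_η) on non-CM non-onto rows NOT p-congruent to a CM row — EMPTY in-table, OPEN class-wide, HARDEST).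
WHY THIS CUT: v5's `stub_etaMC_nonCM_upper` / `_lower` / (v6) `_thm41` had nothing in print off the onto locus for ANY row; v7 settles every
in-table non-CM row IN SHAPE (30/30 are 5-congruent to a CM row by kernel certificates from Fisher's Hesse families) and isolates the genuinely
open class-wide residue in ONE stub. PLANNED RE-CUTS: (i) if the CL25 dictionary reading FAILS at the referee, v7 reverts to v5's primary cut
(archived, ns `.BirthV5`) — the CM branch and (A)/μ stubs are common to both; (ii) `stub_etaMC_nonCM_uncongruent` may split by K_V-class once
g5's class-level structure (`K_V = ℚ(√−(8t²−12t+7))`) is typed. HONEST FRAMING: conditional throughout; no stub is proved by name; the crux,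
RESIDUAL #3 and BSD are as open as before; nothing booked.
-/

/-!
# BC3 birth skeleton v7 CANDIDATE — child crux `PlusEtaMainConjectureNonsurj` (item stmt-BirchSwinnertonDyer-19606, route K8
`QuadraticBranchSignedControl`), written by seat k8eta-c2 g8 (prover-bsd-potss-k8eta-c2-g8-0, 2026-08-27) for the tenure planner to
ADOPT or reshape (planners register skeletons; this file is a proposal, attached to the item and mirrored in HOME/k8eta-c2/g8/).

v7 = g7's v6 candidate (crux ⟸ (A) on the partners + analytic `μ` + the Eisenstein stub on the non-CM rows) with the NON-CM rows RE-CUT by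
«congruent mod `p` to a CM ROW of the crux», on the landed η-main-conjecture TRANSFER:
* k8eta-c2 g8 p552245 + p558472 `CorpuzLei2025_etaPlusMainConjecture_transfer[_anMu]_OPEN` — ONE OPEN binder (`@[conjecture] def`, two
  readings of the anchor's `μ = 0`): Corpuz–Lei arXiv:2508.09733 Thms 1 + 2 + 3 at `i = (p−1)/2`, plus sign (the `η`-main conjecture TRANSFERS
  along a mod-`p` congruence from a good `a_p = 0` curve where it holds with `μ = 0`) — a PREPRINT, flagged `CL25-eta-plus-dictionary`; the
  `η`-twin of bsd-ssimc's `ω⁰` binder;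
* the CM branch of `_of` (k8eta-c2 g7 p536281 `EtaFineRoad.etaMC_cm_of_bt26_of_conjA_partners_of_analyticMu`) proves (C1⁺_η) at EVERY CM row of
  the crux from (A) + the analytic `μ` (mod h26 h22 h6273) — so every non-CM row congruent mod `p` to a CM ROW `V″` of the crux inherits
  (C1⁺_η) through the binder with the SAME analytic `μ` at `V″` (k8eta-c2 g8 p559644 `EtaCMCongruentTransfer.…`), ANY rank, ANY shape of `L_p⁺`,
  with no (A) / `L₀` / analytic `μ` / Thm 4.1 / Hatley–Lei / PT / KO AT THE ROW (CORRECTION of the seat's first cut by «CM UNIT anchor»: in 4 of the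
  9 anchor classes in-table the unit siblings' `5`-twists are ADDITIVE at `5`, so that cut left 16 rows in its open stub; the present cut needs no
  unit anchor and no good-twist condition beyond `V″` being a row); the stronger unit-anchor road (p552531/p555303: anchor side a tree theorem,
  no (A) anywhere) remains available for the 14 rows anchored at `900b1`/`3600bb1`/`10800cj1`/`11025e1`/`14400cz1`;
* k8eta-c2 g8 p559644 `EtaCMCongruentTransfer.plusEtaMainConjectureNonsurj_of_cmConjA_of_transfer_of_uncongruent` — the crux BY NAME from the
  TEXTS below (this skeleton's `_of`).
Registered stubs (5 ≤ stubs_max 7): TWO cite-level / binder inputs — `stub_etaMC_publishedInputs` (the conjunction of the three NAMED PUBLISHED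
facts the composition uses: Kobayashi Thm 2.2η, Thm 6.2/6.3/7.3 i)/Cor 7.2η, Burungale–Tian Thm 2.6 — not a prover target), `stub_etaMC_transferCL25` (the OPEN binder — a PRE claim, not a prover target: it closes when the preprint is refereed
and typed as a Literature fact, or is re-proved here) — and THREE content stubs: `stub_conjA_partners_cm` (Coates–Sujatha (A) for the additive
partners of the CM twists ONLY = v5/v6's `stub_conjA_partners` restricted to `V.HasCM`; in-table after g7: DRS-3.7 on the row / the layer-1/2
criterion, 17/17 residual rows certified modulo analytic Ш; class-wide = Conjecture A for CM curves at an inert prime ⟺ the classical `μ = 0`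
of `ℚ(W[p])_cyc`, Coates–Sujatha Thm. 3.4 — OPEN), `stub_analyticEtaMu_cm` (the analytic `μ(L_p⁺(V,η,X)) = 0` on the CM rows — certified per
row by PARI, k8eta-c2 g3; why_might_fail: a CM row with positive analytic `μ`), `stub_etaMC_nonCM_uncongruent` (NEW: (C1⁺_η) on the non-CM
non-onto rows NOT congruent mod `p` to any CM row of the crux (globally minimal CM curve good at `p` with `a_p = 0`) — EMPTY in-table (all 30 non-CM
rows below `5·10⁵` are `5`-congruent to a CM row: kernel certificates `EtaModFiveCongruenceRecords.modPCongruent_twist5_*`, parts B–F, from Fisher's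
families), OPEN class-wide: by g5's class-level structure `K_V = ℚ(√−(8t²−12t+7))` a `C_ns⁺(5)` class has a CM member iff `K_V = ℚ(√−3)`, so
uncongruent classes exist; nothing in print off the onto locus — hardest). v6's `stub_etaMC_thm41` and `stub_etaMC_nonCM_lower` are no longer
consumed by `_of` (Thm 4.1 is not used; the Eisenstein inclusion survives only inside `stub_etaMC_nonCM_uncongruent`); nor are modularity / GZK /
bsd.S28. The unit-row THEOREMS of v3–v6 may be kept verbatim by the planner (omitted here). `_of` concludes the crux BY NAME through p559644.
-/

set_option linter.dupNamespace false

noncomputable section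

open scoped Classical

open CongruenceSubgroup WeierstrassCurve Field Literature.NumberTheory.EllipticCurves
  Literature.NumberTheory.EllipticCurves.ModularForms Literature.NumberTheory.GaloisRepresentations
  ZpExtension
open Literature.NumberTheory.GaloisCohomology
open Literature.NumberTheory.EllipticCurves.GreenbergVatsal2000
open Literature.NumberTheory.EllipticCurves.Rank1Residual
open Literature.NumberTheory.EllipticCurves.Rank1Residual.Typed
open Summit.BirchSwinnertonDyer.Rank1Residual Summit.BirchSwinnertonDyer.Rank1Residual.Additive
open Summit.BirchSwinnertonDyer.Rank1Residual.O6 (ModPCongruent)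
open Summit.BirchSwinnertonDyer.BirchSwinnertonDyer.Theses.QuadraticBranchSignedControl
open Summit.BirchSwinnertonDyer.BirchSwinnertonDyer.Theorems

namespace Summit.BirchSwinnertonDyer.BirchSwinnertonDyer.Cruxes.PlusEtaMainConjectureNonsurj.Birth

/-- Statement of `stub_etaMC_publishedInputs` (CITE-LEVEL typed inputs, ONE conjunction; not a prover target): Kobayashi Thm 2.2 at `η`,
Kobayashi Thm 6.2/6.3/7.3 i)/Cor 7.2 at `η` on the pinned frame, Burungale–Tian 2026 Thm 2.6 ∘ Kobayashi.
[cite: Kobayashi2003, Thm. 2.2 (p. 5), Thm. 6.2–6.3, Thm. 7.3 i), Cor. 7.2] [cite: BurungaleTian2026, Thm. 2.6] -/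
abbrev Sig.stub_etaMC_publishedInputs : Prop :=
  Kobayashi2003.thm22_etaSignedSelmerDual_finite_torsion ∧ Kobayashi2003.thm62_63_73_etaColemanPoitouTate ∧
    BurungaleTian2026.thm26_etaKatoSequences_charIdeal_upToP_of_cm

/-- Statement of `stub_etaMC_transferCL25` (OPEN BINDER, PRE — not a prover target): the `η`-main-conjecture transfer of Corpuz–Lei 2025
(Thms 1 + 2 + 3 at `i = (p−1)/2`, plus sign; anchor `μ = 0` read analytically), `CorpuzLei2025_etaPlusMainConjecture_transfer_anMu_OPEN`
(k8eta-c2 g8 p558472). [claim: CorpuzLei2025, status: under-review] [cite: GreenbergVatsal2000, Thm. (1.4)] -/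
abbrev Sig.stub_etaMC_transferCL25 : Prop :=
  CorpuzLei2025_etaPlusMainConjecture_transfer_anMu_OPEN

/-- Statement of `stub_conjA_partners_cm` (v5/v6's `stub_conjA_partners` RESTRICTED to the CM twists): statement (A) of Coates–Sujatha for the
additive partner `W` of every non-onto Gss2 twist `V` WITH CM, in the cell's `∃ γ D` currency. [cite: CoatesSujatha2005, §3 statement (A) and Thm. 3.4]
[cite: DeoRaySujatha2023, Thm. 3.7, Lemma 3.6] -/
abbrev Sig.stub_conjA_partners_cm : Prop :=
  ∀ (V : WeierstrassCurve ℚ) [V.IsElliptic] [V.IsGloballyMinimal] (W : WeierstrassCurve ℚ) [W.IsElliptic]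
    [W.IsGloballyMinimal] (C : VariableChange ℚ) (p : ℕ) [Fact p.Prime],
    5 ≤ p → C • W.quadraticTwist ((-1) ^ (p / 2) * p) = V →
    V.HasGoodReductionAtPrime p → V.frobeniusTrace p = 0 →
    ¬ (∀ m : ℕ, V.HasSurjectiveModNGaloisRep (p ^ m : ℕ)) → V.HasCM →
    ∀ (κ : ZpExtension ℚ p), κ.IsCyclotomic →
      ∃ (γ : absoluteGaloisGroup ℚ) (D : W.FineSelmerDualData κ γ),
        Module.Finite ℤ_[p] (RestrictScalars ℤ_[p] (IwasawaAlgebra p) D.X)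

/-- Statement of `stub_analyticEtaMu_cm` (v6's `stub_analyticEtaMu` RESTRICTED to the CM twists): the plus `p`-adic `L`-function at `η` of every
non-onto Gss2 twist WITH CM has UNIT CONTENT (`μ_an = 0`). [cite: Pollack2003, §6] [cite: Kobayashi2003, §4 (p. 8)] [cite: GreenbergVatsal2000, p. 2 (2)] -/
abbrev Sig.stub_analyticEtaMu_cm : Prop :=
  ∀ (V : WeierstrassCurve ℚ) [V.IsElliptic] [V.IsGloballyMinimal] (p : ℕ) [Fact p.Prime],
    5 ≤ p → V.HasGoodReductionAtPrime p → V.frobeniusTrace p = 0 →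
    ¬ (∀ m : ℕ, V.HasSurjectiveModNGaloisRep (p ^ m : ℕ)) → V.HasCM →
    ∀ {N : ℕ} [NeZero N] {f : CuspForm (Gamma0 N) 2}, IsNewformOf V f →
      ∀ (ϖ : ℚ), (if Even (p / 2) then (ϖ : ℝ) * V.realPeriodRat = plusPeriod f
          else (ϖ : ℝ) * V.imaginaryPeriodRat = minusPeriod f) →
      ∀ (Lη : IwasawaAlgebra p), IsQuadraticBranchPlusLFunction f p ϖ Lη → HasUnitContent Lη

/-- Statement of `stub_etaMC_nonCM_uncongruent` (NEW in v7, hardest): (C1⁺_η) on the non-CM non-onto Gss2 twists `V` that are NOT congruent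
mod `p` to any CM row of the crux (no globally minimal CM curve `V″`, good at `p` with `a_p(V″) = 0`, with `V″[p] ≃ V[p]`). EMPTY in-table (all 30
non-CM rows below `5·10⁵` are `5`-congruent to a CM row); OPEN class-wide (nothing in print off the onto locus).
[cite: Kobayashi2003, §4 Even main conjecture (p. 8)] [cite: GreenbergVatsal2000, Thm. (1.4)] -/
abbrev Sig.stub_etaMC_nonCM_uncongruent : Prop :=
  ∀ (V : WeierstrassCurve ℚ) [V.IsElliptic] [V.IsGloballyMinimal] (p : ℕ) [Fact p.Prime],
    5 ≤ p → V.HasGoodReductionAtPrime p → V.frobeniusTrace p = 0 →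
    ¬ (∀ m : ℕ, V.HasSurjectiveModNGaloisRep (p ^ m : ℕ)) → ¬ V.HasCM →
    ¬ (∃ (V'' : WeierstrassCurve ℚ) (_ : V''.IsElliptic) (_ : V''.IsGloballyMinimal),
        V''.HasCM ∧ V''.HasGoodReductionAtPrime p ∧ V''.frobeniusTrace p = 0 ∧ ModPCongruent V'' V p) →
    QuadraticBranchPlusEtaMainConjectureAt V p

theorem stub_etaMC_publishedInputs : Sig.stub_etaMC_publishedInputs := by
  sorry

theorem stub_etaMC_transferCL25 : Sig.stub_etaMC_transferCL25 := by
  sorry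

theorem stub_conjA_partners_cm : Sig.stub_conjA_partners_cm := by
  sorry

theorem stub_analyticEtaMu_cm : Sig.stub_analyticEtaMu_cm := by
  sorry

theorem stub_etaMC_nonCM_uncongruent : Sig.stub_etaMC_nonCM_uncongruent := by
  sorry

/-- Composition (v7): the crux BY NAME — CM rows from (A) + analytic `μ` (Burungale–Tian); non-CM rows congruent to a CM row from the same CM
theorem at that row + the transfer binder; the uncongruent non-CM rows from the stub; k8eta-c2 g8's
`EtaCMCongruentTransfer.plusEtaMainConjectureNonsurj_of_cmConjA_of_transfer_of_uncongruent` (p559644). -/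
theorem PlusEtaMainConjectureNonsurj_of (hpub : Sig.stub_etaMC_publishedInputs) (hCL : Sig.stub_etaMC_transferCL25)
    (hAcm : Sig.stub_conjA_partners_cm) (hμcm : Sig.stub_analyticEtaMu_cm) (huncong : Sig.stub_etaMC_nonCM_uncongruent) :
    PlusEtaMainConjectureNonsurj :=
  EtaCMCongruentTransfer.plusEtaMainConjectureNonsurj_of_cmConjA_of_transfer_of_uncongruent hpub.1 hpub.2.1 hpub.2.2 hCL hAcm
    (fun V _ _ p _ h5 hg ha hns hCM _ _ _ hf ϖ hϖ Lη hL => hμcm V p h5 hg ha hns hCM hf ϖ hϖ Lη hL) huncong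

/-- The child crux from the (sorried) stubs — records that the stub set is complete. -/
theorem plusEtaMainConjectureNonsurj_of_stubs : PlusEtaMainConjectureNonsurj :=
  PlusEtaMainConjectureNonsurj_of stub_etaMC_publishedInputs stub_etaMC_transferCL25 stub_conjA_partners_cm
    stub_analyticEtaMu_cm stub_etaMC_nonCM_uncongruent

end Summit.BirchSwinnertonDyer.BirchSwinnertonDyer.Cruxes.PlusEtaMainConjectureNonsurj.Birth

end
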